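import Summits.AtomisticToContinuum.HydrodynamicLimit.Theses.CollisionIsometryCLT

/-!
# `AprioriBounds` (stmt-AtomisticToContinuum-9519), negative knowledge 1/4: the block-density averaging identity

Load-bearing analysis of the crux `CollisionIsometryCLT.AprioriBounds` (shared verbatim with
`StiffCollisionalRelaxation.AprioriBounds`) by the standing disprover
(`Cruxes/AprioriBounds/Disproof.lean`, refuter-cdisprove-stmt-AtomisticToContinuum-9519-0).

Component (ii) of the crux asks that, with local-Gibbs probability `→ 1`, EVERY block density
`ρ̄(s, x) = empiricalDensityField (Φ_s z) (φ_N(· - x)) = (N+1)⁻¹ ∑ᵢ φ_N(xᵢ(s) - x)` lie in `[c₁, σ⁻³]`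
for all `s ≤ t` and all `x ∈ 𝕋³`.  This file records the DETERMINISTIC constraint behind it:

* `integral_blockDensity`: for every configuration and every integrable kernel,
  `∫ₓ ρ̄(z, x) dx = ∫ φ` (translation/reflection invariance of Haar measure on `𝕋³`); hence some block
  has `ρ̄ ≥ ∫ φ` and some block has `ρ̄ ≤ ∫ φ` (`exists_integral_le_blockDensity`,
  `exists_blockDensity_le_integral`);
* consequently the bad event of (ii) — typed VERBATIM — is ALL of phase space as soon as `σ³ > 1`
  (`badEventII_eq_univ_of_one_lt_sigma_cube`) or `c₁ > 1` (`badEventII_eq_univ_of_one_lt_c1`): every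
  witness of (ii) has `c₁ ≤ 1`, and (ii) can only hold at some `σ` with `σ³ > 1` if the laws lose
  ALL their mass (`not_tendsto_zero_of_frequently_univ`; they do not below close packing — file 3/4,
  FCC packings).

No dynamics and no probability enter; files 2–4 (`AdmissibleKernel`, `FccPacking`,
`WithoutSmallSigma`) turn this into the falsity of (ii) without its smallness threshold.
-/

noncomputable section

open MeasureTheory Filter Set Topology
open scoped ENNReal

namespace Summit.AtomisticToContinuum.HydrodynamicLimit.Theorems

namespace AprioriBoundsNegative

open Literature.MathematicalPhysics.KineticTheory Literature.Analysis.FluidPDE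

/-- Unfolding: the block density `empiricalDensityField z (φ(· - x))` is `N⁻¹ ∑ᵢ φ(xᵢ - x)`. -/
theorem blockDensity_eq {N : ℕ} (z : Config N (Fin 3) T3) (φ : T3 → ℝ) (x : T3) :
    empiricalDensityField z (fun y => φ (y - x)) = (N : ℝ)⁻¹ * ∑ i, φ ((z i).1 - x) := by
  unfold empiricalDensityField
  rw [integral_empiricalMeasure]

/-- **Averaging identity.** The spatial average of the block density over the torus is the mass of
the kernel, for every configuration (`N ≠ 0`): `∫ₓ ρ̄(z, x) dx = ∫ φ` (translation and reflection
invariance of Haar measure on `𝕋³`). -/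
theorem integral_blockDensity {N : ℕ} (hN : N ≠ 0) (z : Config N (Fin 3) T3) {φ : T3 → ℝ}
    (hφ : Integrable φ) : ∫ x, empiricalDensityField z (fun y => φ (y - x)) = ∫ y, φ y := by
  haveI : (volume : Measure T3).IsNegInvariant :=
    Measure.IsAddHaarMeasure.isNegInvariant_of_regular _
  simp_rw [blockDensity_eq]
  rw [integral_const_mul, integral_finsetSum _ (fun i _ => hφ.comp_sub_left (z i).1)]
  simp_rw [integral_sub_left_eq_self φ volume]
  rw [Finset.sum_const, Finset.card_univ, Fintype.card_fin, nsmul_eq_mul, ← mul_assoc,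
    inv_mul_cancel₀ (Nat.cast_ne_zero.2 hN), one_mul]

/-- The block density is integrable in the block centre `x`. -/
theorem integrable_blockDensity {N : ℕ} (z : Config N (Fin 3) T3) {φ : T3 → ℝ}
    (hφ : Integrable φ) : Integrable (fun x => empiricalDensityField z (fun y => φ (y - x))) := by
  haveI : (volume : Measure T3).IsNegInvariant :=
    Measure.IsAddHaarMeasure.isNegInvariant_of_regular _
  have : (fun x => empiricalDensityField z (fun y => φ (y - x))) =
      fun x => (N : ℝ)⁻¹ * ∑ i, φ ((z i).1 - x) := funext (blockDensity_eq z φ)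
  rw [this]
  exact (integrable_finsetSum _ fun i _ => hφ.comp_sub_left (z i).1).const_mul _

/-- **Some block is at least as dense as the mean**: `∃ x, ∫ φ ≤ ρ̄(z, x)`. -/
theorem exists_integral_le_blockDensity {N : ℕ} (hN : N ≠ 0) (z : Config N (Fin 3) T3)
    {φ : T3 → ℝ} (hφ : Integrable φ) :
    ∃ x, ∫ y, φ y ≤ empiricalDensityField z (fun y => φ (y - x)) := by
  obtain ⟨x, hx⟩ := exists_integral_le (integrable_blockDensity z hφ)
  exact ⟨x, (integral_blockDensity hN z hφ) ▸ hx⟩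

/-- **Some block is at most as dense as the mean**: `∃ x, ρ̄(z, x) ≤ ∫ φ`. -/
theorem exists_blockDensity_le_integral {N : ℕ} (hN : N ≠ 0) (z : Config N (Fin 3) T3)
    {φ : T3 → ℝ} (hφ : Integrable φ) :
    ∃ x, empiricalDensityField z (fun y => φ (y - x)) ≤ ∫ y, φ y := by
  obtain ⟨x, hx⟩ := exists_le_integral (integrable_blockDensity z hφ)
  exact ⟨x, (integral_blockDensity hN z hφ) ▸ hx⟩

/-- **Tightness in `σ`.** If `σ³ > 1` then, for `t ≥ 0` and any kernel of mass `1`, the bad event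
of (ii) (typed verbatim) is ALL of phase space: at `s = 0` some block has `ρ̄ ≥ 1`, hence `ρ̄ σ³ > 1`.
No probability, no dynamics. -/
theorem badEventII_eq_univ_of_one_lt_sigma_cube {σ : ℝ} (hσ : 1 < σ ^ 3) {N : ℕ}
    (Φ : HardSphereFlow (Torus.geometry (Fin 3)) (hsDiameter σ N) (N + 1))
    {φ : ℕ → T3 → ℝ} (hφ : Integrable (φ N)) (hφ1 : ∫ y, φ N y = 1) {t : ℝ} (ht : 0 ≤ t)
    (c₁ : ℝ) :
    {z | ∃ s ∈ Icc 0 t, ∃ x : T3,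
      empiricalDensityField (Φ.flow s z) (fun y => φ N (y - x)) < c₁ ∨
        1 < empiricalDensityField (Φ.flow s z) (fun y => φ N (y - x)) * σ ^ 3} = univ := by
  refine eq_univ_of_forall fun z => ⟨0, ⟨le_rfl, ht⟩, ?_⟩
  obtain ⟨x, hx⟩ := exists_integral_le_blockDensity (Nat.succ_ne_zero N) (Φ.flow 0 z) hφ
  refine ⟨x, Or.inr ?_⟩
  rw [hφ1] at hx
  have h1 : (1 : ℝ) * σ ^ 3 ≤ empiricalDensityField (Φ.flow 0 z) (fun y => φ N (y - x)) * σ ^ 3 :=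
    mul_le_mul_of_nonneg_right hx (by positivity)
  exact lt_of_lt_of_le (by simpa using hσ) h1

/-- **Tightness in `c₁`.** If `c₁ > 1` then, for `t ≥ 0` and any kernel of mass `1`, the bad event
of (ii) is ALL of phase space: at `s = 0` some block has `ρ̄ ≤ 1 < c₁`.  So every witness of (ii)
has `c₁ ≤ 1` (the mean density), whatever the profile. -/
theorem badEventII_eq_univ_of_one_lt_c1 {σ : ℝ} {N : ℕ}
    (Φ : HardSphereFlow (Torus.geometry (Fin 3)) (hsDiameter σ N) (N + 1))
    {φ : ℕ → T3 → ℝ} (hφ : Integrable (φ N)) (hφ1 : ∫ y, φ N y = 1) {t : ℝ} (ht : 0 ≤ t)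
    {c₁ : ℝ} (hc : 1 < c₁) :
    {z | ∃ s ∈ Icc 0 t, ∃ x : T3,
      empiricalDensityField (Φ.flow s z) (fun y => φ N (y - x)) < c₁ ∨
        1 < empiricalDensityField (Φ.flow s z) (fun y => φ N (y - x)) * σ ^ 3} = univ := by
  refine eq_univ_of_forall fun z => ⟨0, ⟨le_rfl, ht⟩, ?_⟩
  obtain ⟨x, hx⟩ := exists_blockDensity_le_integral (Nat.succ_ne_zero N) (Φ.flow 0 z) hφ
  rw [hφ1] at hx
  exact ⟨x, Or.inl (lt_of_le_of_lt hx hc)⟩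

/-- If the laws keep full mass for infinitely many `N`, the probability of an event that is ALL of
phase space does not tend to `0`. -/
theorem not_tendsto_zero_of_frequently_univ {α : ℕ → Type*} [∀ N, MeasurableSpace (α N)]
    (P : (N : ℕ) → Measure (α N)) (E : (N : ℕ) → Set (α N)) (hE : ∀ N, E N = univ)
    (hP : ∃ᶠ N in atTop, P N univ = 1) :
    ¬ Tendsto (fun N => P N (E N)) atTop (𝓝 0) := by
  intro h
  have hev : ∀ᶠ N in atTop, P N (E N) < 1 :=
    h.eventually (gt_mem_nhds (by norm_num : (0 : ℝ≥0∞) < 1))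
  obtain ⟨N, hN1, hN2⟩ := (hP.and_eventually hev).exists
  rw [hE N, hN1] at hN2
  exact lt_irrefl _ hN2

end AprioriBoundsNegative

end Summit.AtomisticToContinuum.HydrodynamicLimit.Theorems

end
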